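import Mathlib.Analysis.SpecialFunctions.Trigonometric.Deriv
import Mathlib.Analysis.SpecialFunctions.Pow.Real
import Mathlib.MeasureTheory.Integral.IntervalIntegral.Basic
import Mathlib.MeasureTheory.Measure.WithDensity
import Mathlib.Order.LiminfLimsup
import Literature.MathematicalPhysics.KineticTheory.FouriersLaw
import HarnessLib

/-!
# Barrier (AtomisticToContinuum / FouriersLaw): asymptotic localization of energy at weak coupling (anti-continuum limit)

`Literature/Barriers/AtomisticToContinuum/` (D-0021 barrier catalogue). Sub-problem `FouriersLaw`
(`Literature.MathematicalPhysics.KineticTheory.HeatConduction.FouriersLaw`, `Literature/MathematicalPhysics/KineticTheory/FouriersLaw.lean`):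
`κ(T) = lim_N N · lim_{δT→0} J_N/δT` exists with `0 < κ(T) < ∞` for the pinned anharmonic chain.
This entry records the rigorous obstruction to reaching a POSITIVE conductivity by perturbation
theory in the inter-site coupling `ε` around uncoupled strongly anharmonic oscillators (the
"anti-continuum" or weak-coupling limit, the expansion point of the weak-coupling programme
Liverani–Olla 2012 / Dolgopyat–Liverani 2011): for the rotor chain and for a discrete non-linear
Schrödinger chain, every order of that expansion sees NO transport.

## Source and printed statements

W. De Roeck, F. Huveneers, *Asymptotic localization of energy in nondisordered oscillator chains*,
Comm. Pure Appl. Math. **68** (2015) 1532–1568, arXiv:1305.5127 (locators of the arXiv version).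

§2.1 (rotor chain): `N ≥ 1` odd, `ℤ_N = {-(N-1)/2, …, (N-1)/2}`, `γ ≥ 0`, phase space
`Ω_N = (𝕋 × ℝ)^N`, `𝕋 = ℝ/2πℤ`,
`H(q, ω) = ½ ∑_x ω_x² + ε ∑_x (γ(1 - cos q_x) + (1 - cos(q_x - q_{x+1}))) = ∑_x H_x`,
`H_x = D_x(ω) + ε V_x(q)`, "with the convention `q_{(N+1)/2} = q_{(N-1)/2}`, so that free boundary
conditions are imposed on both sides"; Hamilton's equations `q̇ = ∇_ω H`, `ω̇ = -∇_q H`, flow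
`X^t_ε`. §2.2: `L_f g = {f, g} = ∇_ω f · ∇_q g - ∇_q f · ∇_ω g`; current
`ε J_{a,a+1} = L_H ∑_{x>a} H_x = {H_a, H_{a+1}}` (§2.4: "`ε J_{a,a+1} = ε ω_{a+1} sin(q_a - q_{a+1})`");
`ε 𝒥 = ε N^{-1/2} ∑_a J_{a,a+1}`; Gibbs state `⟨f⟩_T = Z(T)⁻¹ ∫_Ω f e^{-H/T} dq dω`; Green–Kubo
conductivity (2.6) `κ(T, ε) = lim_{t→∞} lim_{N→∞} T⁻² ⟨(ε t^{-1/2} ∫₀ᵗ 𝒥_N(X^s_ε) ds)²⟩_T`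
"if the limits exist".

* Theorem 1 (the: decomposition of the current): "Let the Hamiltonian be given by (2.1) or (2.3).
  Let `T > 0` be fixed. Choose any `n ≥ 1` and let then `C_n < +∞` be large enough. For any
  `N ≥ 1` and `a ∈ ℤ_N`, the current across the bond `(a, a+1)` can be decomposed as
  `ε J_{a,a+1} = L_H U_a + ε^{n+1} G_a`. The functions `U_a` and `G_a` are smooth, of zero
  average, `⟨U_a⟩_T = ⟨G_a⟩_T = 0`, and they depend only on variables labeled by `z ∈ ℤ_N` with
  `|z - a| ≤ C_n`, and satisfy the bounds `⟨U_a²⟩_T ≤ C_n ε^{1/4}`, `⟨(∂_♯ U_a)²⟩_T ≤ C_n ε^{-1/4}`,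
  `⟨G_a²⟩_T ≤ C_n`, `⟨(∂_♯ G_a)²⟩_T ≤ C_n` where `♯` stands for any of the variables."
* Before Theorem 2: "The analysis of the conductivity as defined by (2.6) is probably out of reach
  at the present time. … Our result is quite similar in spirit to results about weak coupling
  limits in such systems, e.g. [Lukkarinen–Spohn] [Dolgopyat–Liverani] [Liverani–Olla], where one
  describes the dynamics in a scaling limit where coupling vanishes but time goes to infinity.
  However, in our case, these scaling limits are trivial in the sense that we do not see any
  transport on the time scales that we study. … We believe the next theorem to be a strong
  indication that `κ(T, ε) = 𝒪(ε^m)` for any `m ≥ 1`. To establish this rigorously, one would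
  need to exchange the limits `t → ∞` and `ε → 0`."
* Theorem 2 (the: weak coupling conductivity): "Let `T > 0` be fixed. Let `1 ≤ m < n`. Then
  `lim_{t→∞} limsup_{ε→0} limsup_{N→∞} (ε^{-m}/T²) ⟨(ε (ε^{-n}t)^{-1/2} ∫₀^{ε^{-n}t} 𝒥_N(X^s_ε) ds)²⟩_T = 0`."
* After Theorem 2: "One could speculate whether some non-perturbative effects could lead to a
  breakdown of the conjecture `κ(T, ε) = 𝒪(ε^m)`. We cannot exclude this, and in fact we do not
  even rigorously know whether the chains we consider are normal conductors for some `ε > 0`, that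
  is, whether `κ(T, ε) < ∞`." Theorem 3: with an energy-conserving velocity-flip noise of
  intensity `ε^{n+1}` added, the conductivity is `≤ C_n ε^n`.
* Theorem 4 (the: nekhoroshev): "Let `T > 0` be fixed. For any `n ≥ 1`, there is `C_n < ∞` such
  that, for sufficiently small `ε > 0`, and for any `I` [discrete interval, `H_I = ∑_{x∈I} H_x`],
  `⟨(H_I(X^t_ε) - H_I)²⟩_T ≤ C_n ε^{1/4}` for any `0 ≤ t ≤ ε^{-n}`."
* §2.4 "Temperature dependence": `κ(ε, T) = σ⁻¹ κ(σ²ε, σ²T)` (rotors), hence "We therefore also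
  conjecture for the two chains that `κ(T, ε ∼ 1) = 𝒪(1/T^m)` for every `m ≥ 1` as `T → ∞`."
  "Other models": for `H = ∑ (p_x²/2 + q_x⁴/4 + (ε/2)(q_x - q_{x+1})²)` (2.12) "part of our proof
  would likely break down … The generalisation of our theorems to the chain defined by (2.12)
  appears thus to us as an open question." "How optimal are our bounds?": "It is numerically
  observed that the chains under study are normal conductors … so that we expect localization of
  energy to be at best asymptotic."

Context in print. Bernardin 2014 (lecture notes, arXiv:1407.7023; Springer Proc. Math. Stat. 129, 2015), §2.1.3: "Some authors (see [De
Roeck–Huveneers] and references therein) conjecture that, in some cases, the conductivity of the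
deterministic chain `κ(ε, 0)` has a trivial weak coupling expansion (`κ(ε, 0) = O(εⁿ)` for any
`n ≥ 2`)."; ibid. item 3: for the harmonic chain with quartic pinning and velocity-flip noise
`γ`, "`lim sup_{γ→0} κ₂(γ) < ∞`. This upper bound does not prevent the possibility that
`lim_{γ→0} κ₂(γ) = 0`."

## Contents

* The rotor chain on the tree's finite phase space `PhaseSpace N = (Fin N → ℝ) × (Fin N → ℝ)`
  (angles lifted to `ℝ`, all observables `2π`-periodic): `RotorChain.sitePotential`,
  `siteEnergy` (`H_x`), `hamiltonian`, `intervalEnergy` (`H_I`), `bondCurrent` (`J_{a,a+1}`),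
  `totalCurrent` (`𝒥_N`), `liouville` (`L_H = {H, ·}`), `IsFlow` (flow maps of Hamilton's
  equations), `domain` (`[0, 2π)^N × ℝ^N`, a fundamental domain of `Ω_N`), `gibbsMeasure`
  (`Z⁻¹ e^{-H/T} dq dω` on the domain), `IsAnglePeriodic`, `DependsOnlyNear`.
* `DeRoeckHuveneers2015_thm1` — NAMED FACT, Theorem 1 for the rotor chain.
* `DeRoeckHuveneers2015_thm4` — NAMED FACT, Theorem 4 for the rotor chain (constants uniform in
  `N`, as in Theorem 1 and its proof in §7).
* `DeRoeckHuveneers2015_thm2` — NAMED FACT, Theorem 2 for the rotor chain, carrying the BARRIER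
  block; `finiteTimeConductivity` is the quantity under the three limits.
* Proved API: `isFlow_freeRotation` (at `ε = 0` the free rotation `(q + tω, ω)` is a flow — the
  unperturbed, energy-frozen dynamics), `bondCurrent_eq_zero_of_le`, `sitePotential_nonneg`,
  `hamiltonian_nonneg`; `rotorChain ε γr γb : OscillatorChain` (explicit bath constant `γb`) with
  `RotorChain.hamiltonian_eq_oscillatorChain`.

## Design notes

* Sites are indexed by `Fin N` instead of `ℤ_N = {-(N-1)/2, …, (N-1)/2}` (a relabelling); the
  free boundary convention makes the last site's bond term and bond current vanish (empty sum over
  `y` with `y = x + 1`). `N` is restricted to odd values as printed (weaker than all `N`).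
* Functions on `Ω_N = (𝕋 × ℝ)^N` are functions on `PhaseSpace N` that are `2π`-periodic in each
  angle (`IsAnglePeriodic`); Gibbs averages are integrals over the fundamental domain
  `[0, 2π)^N × ℝ^N` against `Z⁻¹ e^{-H/T}` (`gibbsMeasure`); the lifted flow commutes with
  `2π`-shifts, so `⟨F ∘ X^t⟩_T` is computed on the domain.
* Flows are quantified universally over maps satisfying Hamilton's equations with `Φ_0 = id` and
  joint continuity (the vector field `(ω, -ε∇_q V)` is smooth and globally Lipschitz, so the flow
  exists, is unique and smooth; universality over such `Φ` is then harmless and avoids choosing).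
* "Sufficiently small `ε`" is `∃ ε₀ > 0, ∀ ε ∈ (0, ε₀)`; Theorem 1 is vendored with the same
  restriction, which is equivalent to the printed form without it (for `ε ≥ ε₀` take `U_a = 0`,
  `G_a = ε⁻ⁿ J_{a,a+1}` and enlarge `C`, using `⟨ω²⟩_T = T`). Square-integrability is asserted
  alongside each printed `L²` bound so that no bound is about a Bochner junk value.
* `rotorChain ε γr γb : OscillatorChain` registers the rotor chain's potentials in the tree's chain
  interface (`U(q) = εγr(1 - cos q)`, `V(r) = ε(1 - cos r)`, explicit Langevin bath constant `γb`
  as for `pinnedChain`), with `RotorChain.hamiltonian_eq_oscillatorChain` identifying the two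
  Hamiltonians. It does NOT provide a boundary-driven rotor statement: on the tree's phase space
  (angles in `ℝ^N`) the Langevin rotor chain has no stationary probability measure for any `γb`
  (bounded periodic potentials; for `γb = 0` uniqueness fails as well), so
  `OscillatorChain.FouriersLawFor (rotorChain ε γr γb)` is false for reasons unrelated to
  transport, and the tree has no torus version of `FouriersLawFor`. The BARRIER block therefore
  bears on the positivity clause of any such (torus) rotor statement and, directly, on De
  Roeck–Huveneers' equilibrium Green–Kubo `κ(T, ε)` (see the `κ = κ_GK` caveat in the block); site
  energies, the torus Gibbs state and the currents `J_{a,a+1}` stay rotor-specific (the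
  `OscillatorChain` Gibbs weight on `ℝ^N` angles is not normalisable for periodic potentials).
* Theorem 2's triple limit is written with `Filter.limsup` in `ℝ≥0∞` (inner quantity
  `finiteTimeConductivity ≥ 0`), `N → ∞` along odd `N`, `ε → 0⁺`, then `t → ∞`.
* The DNLS chain (2.3) versions of Theorems 1, 2, 4 and the noisy Theorem 3 are not restated in
  Lean (same shape; Theorem 3 needs the jump Markov process).
-/

noncomputable section

open MeasureTheory Filter Topology Set
open scoped ContDiff ENNReal

namespace Literature.Barriers.AtomisticToContinuum.HeatConduction

namespace RotorChain

/-! ### The rotor chain (De Roeck–Huveneers 2015, §2.1) -/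

/-- The potential energy attached to site `x`: `V_x(q) = γ(1 - cos q_x) + (1 - cos(q_x - q_{x+1}))`,
the bond term being absent for the last site (free boundary, "`q_{(N+1)/2} = q_{(N-1)/2}`").
[cite: DeRoeckHuveneers2015, §2.1 eq. (2.1)] -/
def sitePotential (N : ℕ) (γ : ℝ) (q : Fin N → ℝ) (x : Fin N) : ℝ :=
  γ * (1 - Real.cos (q x)) +
    ∑ y : Fin N, if y.val = x.val + 1 then (1 - Real.cos (q x - q y)) else 0

/-- The site energy `H_x(q, ω) = ω_x²/2 + ε V_x(q)`. [cite: DeRoeckHuveneers2015, §2.1 eq. (2.1)] -/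
def siteEnergy (N : ℕ) (ε γ : ℝ) (z : Literature.MathematicalPhysics.KineticTheory.HeatConduction.PhaseSpace N) (x : Fin N) : ℝ :=
  z.2 x ^ 2 / 2 + ε * sitePotential N γ z.1 x

/-- The rotor Hamiltonian `H = ∑_x H_x = ½∑ ω_x² + ε ∑_x (γ(1 - cos q_x) + (1 - cos(q_x - q_{x+1})))`.
[cite: DeRoeckHuveneers2015, §2.1 eq. (2.1)] -/
def hamiltonian (N : ℕ) (ε γ : ℝ) (z : Literature.MathematicalPhysics.KineticTheory.HeatConduction.PhaseSpace N) : ℝ :=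
  ∑ x : Fin N, siteEnergy N ε γ z x

/-- The energy `H_I = ∑_{x ∈ I} H_x` of the discrete interval `I = {a₁, …, a₂}`.
[cite: DeRoeckHuveneers2015, §2.3 before Thm 4] -/
def intervalEnergy (N : ℕ) (ε γ : ℝ) (a₁ a₂ : Fin N) (z : Literature.MathematicalPhysics.KineticTheory.HeatConduction.PhaseSpace N) : ℝ :=
  ∑ x ∈ Finset.Icc a₁ a₂, siteEnergy N ε γ z x

/-- The energy current `J_{a,a+1} = ω_{a+1} sin(q_a - q_{a+1})` across the bond `(a, a+1)`
(from `ε J_{a,a+1} = {H_a, H_{a+1}}`), zero for the last site. [cite: DeRoeckHuveneers2015, §2.2 eq. (2.5) and §2.4] -/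
def bondCurrent (N : ℕ) (a : Fin N) (z : Literature.MathematicalPhysics.KineticTheory.HeatConduction.PhaseSpace N) : ℝ :=
  ∑ y : Fin N, if y.val = a.val + 1 then z.2 y * Real.sin (z.1 a - z.1 y) else 0

/-- The normalised total current `𝒥_N = N^{-1/2} ∑_a J_{a,a+1}`. [cite: DeRoeckHuveneers2015, §2.2] -/
def totalCurrent (N : ℕ) (z : Literature.MathematicalPhysics.KineticTheory.HeatConduction.PhaseSpace N) : ℝ :=
  (∑ a : Fin N, bondCurrent N a z) / Real.sqrt N

/-- The Liouville operator `L_H U = {H, U} = ∑_x (∂_{ω_x}H ∂_{q_x}U - ∂_{q_x}H ∂_{ω_x}U)` of the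
rotor chain (coordinate partial derivatives `partialQ`, `partialP` of the tree).
[cite: DeRoeckHuveneers2015, §2.2 eq. (2.4)] -/
def liouville (N : ℕ) (ε γ : ℝ) (U : Literature.MathematicalPhysics.KineticTheory.HeatConduction.PhaseSpace N → ℝ) (z : Literature.MathematicalPhysics.KineticTheory.HeatConduction.PhaseSpace N) : ℝ :=
  ∑ x : Fin N, (Literature.MathematicalPhysics.KineticTheory.HeatConduction.partialP x (hamiltonian N ε γ) z * Literature.MathematicalPhysics.KineticTheory.HeatConduction.partialQ x U z -
    Literature.MathematicalPhysics.KineticTheory.HeatConduction.partialQ x (hamiltonian N ε γ) z * Literature.MathematicalPhysics.KineticTheory.HeatConduction.partialP x U z)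

/-- `Φ : ℝ → PhaseSpace N → PhaseSpace N` is a (the) flow of Hamilton's equations of the rotor
chain, `q̇_x = ω_x`, `ω̇_x = -∂_{q_x} H`, with `Φ_0 = id`, jointly continuous in `(t, z)`
("we denote the Hamiltonian flow by `(X^t_ε(q, ω))_{t ≥ 0}`"; angles lifted to `ℝ`).
[cite: DeRoeckHuveneers2015, §2.1 eq. (2.2)] -/
def IsFlow (N : ℕ) (ε γ : ℝ) (Φ : ℝ → Literature.MathematicalPhysics.KineticTheory.HeatConduction.PhaseSpace N → Literature.MathematicalPhysics.KineticTheory.HeatConduction.PhaseSpace N) : Prop :=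
  Continuous (fun p : ℝ × Literature.MathematicalPhysics.KineticTheory.HeatConduction.PhaseSpace N => Φ p.1 p.2) ∧ (∀ z, Φ 0 z = z) ∧
    ∀ (z : Literature.MathematicalPhysics.KineticTheory.HeatConduction.PhaseSpace N) (x : Fin N) (t : ℝ),
      HasDerivAt (fun s => (Φ s z).1 x) ((Φ t z).2 x) t ∧
        HasDerivAt (fun s => (Φ s z).2 x) (-(Literature.MathematicalPhysics.KineticTheory.HeatConduction.partialQ x (hamiltonian N ε γ) (Φ t z))) t

/-- A fundamental domain of `Ω_N = (𝕋 × ℝ)^N` in the lift: angles in `[0, 2π)`, momenta free.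
[cite: DeRoeckHuveneers2015, §2.1] -/
def domain (N : ℕ) : Set (Literature.MathematicalPhysics.KineticTheory.HeatConduction.PhaseSpace N) :=
  {z | ∀ x : Fin N, z.1 x ∈ Ico 0 (2 * Real.pi)}

/-- The Boltzmann weight `e^{-H(q, ω)/T}`. [cite: DeRoeckHuveneers2015, §2.2] -/
def gibbsWeight (N : ℕ) (T ε γ : ℝ) (z : Literature.MathematicalPhysics.KineticTheory.HeatConduction.PhaseSpace N) : ℝ :=
  Real.exp (-(hamiltonian N ε γ z) / T)

/-- The partition function `Z(T) = ∫_{Ω_N} e^{-H/T} dq dω` (computed on the fundamental domain).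
[cite: DeRoeckHuveneers2015, §2.2] -/
def partitionFunction (N : ℕ) (T ε γ : ℝ) : ℝ :=
  ∫ z in domain N, gibbsWeight N T ε γ z

/-- The Gibbs state `⟨f⟩_T = Z(T)⁻¹ ∫_{Ω_N} f e^{-H/T} dq dω` of the rotor chain as a measure on
the lift, carried by the fundamental domain `[0, 2π)^N × ℝ^N`. [cite: DeRoeckHuveneers2015, §2.2] -/
def gibbsMeasure (N : ℕ) (T ε γ : ℝ) : Measure (Literature.MathematicalPhysics.KineticTheory.HeatConduction.PhaseSpace N) :=
  (ENNReal.ofReal (partitionFunction N T ε γ))⁻¹ •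
    (volume.restrict (domain N)).withDensity fun z => ENNReal.ofReal (gibbsWeight N T ε γ z)

/-- `F` is a function on `Ω_N`: `2π`-periodic in every angle `q_x`. [cite: DeRoeckHuveneers2015, §2.1] -/
def IsAnglePeriodic (N : ℕ) (F : Literature.MathematicalPhysics.KineticTheory.HeatConduction.PhaseSpace N → ℝ) : Prop :=
  ∀ (z : Literature.MathematicalPhysics.KineticTheory.HeatConduction.PhaseSpace N) (x : Fin N), F (Function.update z.1 x (z.1 x + 2 * Real.pi), z.2) = F z

/-- `F` "depends only on variables labeled by `z ∈ ℤ_N` with `|z - a| ≤ R`": it takes equal values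
on configurations that agree at all sites within distance `R` of `a`. [cite: DeRoeckHuveneers2015, §2.3 Thm 1] -/
def DependsOnlyNear (N : ℕ) (a : Fin N) (R : ℝ) (F : Literature.MathematicalPhysics.KineticTheory.HeatConduction.PhaseSpace N → ℝ) : Prop :=
  ∀ z z' : Literature.MathematicalPhysics.KineticTheory.HeatConduction.PhaseSpace N,
    (∀ x : Fin N, |(x.val : ℝ) - a.val| ≤ R → z.1 x = z'.1 x ∧ z.2 x = z'.2 x) → F z = F z'

/-- The quantity under the limits in Theorem 2:
`(ε^{-m}/T²) ⟨(ε (ε^{-n}t)^{-1/2} ∫₀^{ε^{-n}t} 𝒥_N(X^s_ε) ds)²⟩_T ∈ [0, ∞]`, for a flow map `Φ` of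
the `N`-site chain at coupling `ε`. [cite: DeRoeckHuveneers2015, §2.3 Thm 2] -/
def finiteTimeConductivity (γ T ε : ℝ) (n m : ℕ) (N : ℕ) (Φ : ℝ → Literature.MathematicalPhysics.KineticTheory.HeatConduction.PhaseSpace N → Literature.MathematicalPhysics.KineticTheory.HeatConduction.PhaseSpace N)
    (t : ℝ) : ℝ≥0∞ :=
  ENNReal.ofReal (ε ^ (-(m : ℝ)) / T ^ 2) *
    ∫⁻ z, ENNReal.ofReal
      ((ε / Real.sqrt (ε ^ (-(n : ℝ)) * t) *
          ∫ s in (0 : ℝ)..(ε ^ (-(n : ℝ)) * t), totalCurrent N (Φ s z)) ^ 2) ∂(gibbsMeasure N T ε γ)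

/-! ### API -/

/-- The last site carries no bond current (free boundary). [folklore] -/
theorem bondCurrent_eq_zero_of_le {N : ℕ} (a : Fin N) (ha : N ≤ a.val + 1) (z : Literature.MathematicalPhysics.KineticTheory.HeatConduction.PhaseSpace N) :
    bondCurrent N a z = 0 := by
  unfold bondCurrent
  refine Finset.sum_eq_zero fun y _ => ?_
  have hy : y.val ≠ a.val + 1 := by have := y.isLt; omega
  simp [hy]

/-- The site potentials are non-negative for `γ ≥ 0`. [folklore] -/
theorem sitePotential_nonneg {N : ℕ} {γ : ℝ} (hγ : 0 ≤ γ) (q : Fin N → ℝ) (x : Fin N) :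
    0 ≤ sitePotential N γ q x := by
  unfold sitePotential
  refine add_nonneg (mul_nonneg hγ (by linarith [Real.cos_le_one (q x)])) ?_
  refine Finset.sum_nonneg fun y _ => ?_
  split_ifs
  · linarith [Real.cos_le_one (q x - q y)]
  · exact le_rfl

/-- The Hamiltonian is non-negative for `ε, γ ≥ 0` (so `e^{-H/T} ≤ 1`). [folklore] -/
theorem hamiltonian_nonneg {N : ℕ} {ε γ : ℝ} (hε : 0 ≤ ε) (hγ : 0 ≤ γ) (z : Literature.MathematicalPhysics.KineticTheory.HeatConduction.PhaseSpace N) :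
    0 ≤ hamiltonian N ε γ z := by
  unfold hamiltonian siteEnergy
  exact Finset.sum_nonneg fun x _ =>
    add_nonneg (by positivity) (mul_nonneg hε (sitePotential_nonneg hγ z.1 x))

/-- At `ε = 0` the Hamiltonian `½∑ω²` does not depend on the angles: `∂_{q_x} H = 0`. [folklore] -/
theorem partialQ_hamiltonian_zero {N : ℕ} (γ : ℝ) (x : Fin N) (z : Literature.MathematicalPhysics.KineticTheory.HeatConduction.PhaseSpace N) :
    Literature.MathematicalPhysics.KineticTheory.HeatConduction.partialQ x (hamiltonian N 0 γ) z = 0 := by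
  simp [Literature.MathematicalPhysics.KineticTheory.HeatConduction.partialQ, hamiltonian, siteEnergy]

/-- The free rotation `(q, ω) ↦ (q + tω, ω)`, the uncoupled (`ε = 0`) dynamics in which every
site energy is frozen. [cite: DeRoeckHuveneers2015, §1] -/
def freeRotation (N : ℕ) (t : ℝ) (z : Literature.MathematicalPhysics.KineticTheory.HeatConduction.PhaseSpace N) : Literature.MathematicalPhysics.KineticTheory.HeatConduction.PhaseSpace N :=
  (fun x => z.1 x + t * z.2 x, z.2)

/-- Non-vacuity of `IsFlow`: at `ε = 0` the free rotation is a flow of Hamilton's equations.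
[folklore] -/
theorem isFlow_freeRotation (N : ℕ) (γ : ℝ) : IsFlow N 0 γ (freeRotation N) := by
  refine ⟨?_, fun z => by simp [freeRotation], fun z x t => ⟨?_, ?_⟩⟩
  · apply Continuous.prodMk
    · refine continuous_pi fun x => ?_
      have h1 : Continuous fun p : ℝ × Literature.MathematicalPhysics.KineticTheory.HeatConduction.PhaseSpace N => p.2.1 x :=
        (continuous_apply x).comp (continuous_fst.comp continuous_snd)
      have h2 : Continuous fun p : ℝ × Literature.MathematicalPhysics.KineticTheory.HeatConduction.PhaseSpace N => p.2.2 x :=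
        (continuous_apply x).comp (continuous_snd.comp continuous_snd)
      exact h1.add (continuous_fst.mul h2)
    · exact continuous_snd.comp continuous_snd
  · simp only [freeRotation]
    have h := ((hasDerivAt_id t).const_mul (z.2 x)).const_add (z.1 x)
    simpa [mul_comm] using h
  · simp only [freeRotation, partialQ_hamiltonian_zero, neg_zero]
    exact hasDerivAt_const t (z.2 x)

end RotorChain

/-- The rotor chain as an `OscillatorChain` of the tree: rotor pinning strength `γr`
(`U(q) = εγr(1 - cos q)`), coupling `V(r) = ε(1 - cos r)`, and — as for `pinnedChain` — an explicit
Langevin BATH constant `γb` (the structure field `OscillatorChain.γ`; it does not enter the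
Hamiltonian). CAVEAT: the tree's `OscillatorChain.PhaseSpace` has positions in `ℝ^N`, not `𝕋^N`;
for these bounded `2π`-periodic potentials the Langevin chain on `ℝ^N` has no stationary
probability measure (the lifted angles diffuse), so clause (i) of
`OscillatorChain.FouriersLawFor (rotorChain ε γr γb)` fails for EVERY `γb` and that `Prop` is
false for reasons unrelated to transport — the registration only supplies the potentials and the
Hamiltonian identity below; the tree has no torus version of `FouriersLawFor`.
[cite: DeRoeckHuveneers2015, §2.1 eq. (2.1)] -/
def rotorChain (ε γr γb : ℝ) : Literature.MathematicalPhysics.KineticTheory.HeatConduction.OscillatorChain where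
  U q := ε * (γr * (1 - Real.cos q))
  V r := ε * (1 - Real.cos r)
  γ := γb

/-- The bath constant of `rotorChain ε γr γb` is `γb`. [folklore] -/
@[simp] theorem rotorChain_γ (ε γr γb : ℝ) : (rotorChain ε γr γb).γ = γb := rfl

/-- The rotor Hamiltonian of this file is the `OscillatorChain` Hamiltonian of `rotorChain ε γ γb`
for every bath constant `γb` (free ends; `cos` is even, so the bond term `1 - cos(q_x - q_{x+1})`
equals `V(q_{x+1} - q_x)`). [cite: DeRoeckHuveneers2015, §2.1 eq. (2.1)] -/
theorem RotorChain.hamiltonian_eq_oscillatorChain (N : ℕ) (ε γ γb : ℝ) (z : Literature.MathematicalPhysics.KineticTheory.HeatConduction.PhaseSpace N) :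
    RotorChain.hamiltonian N ε γ z = (rotorChain ε γ γb).hamiltonian N z := by
  simp only [RotorChain.hamiltonian, RotorChain.siteEnergy, RotorChain.sitePotential,
    Literature.MathematicalPhysics.KineticTheory.HeatConduction.OscillatorChain.hamiltonian, rotorChain]
  rw [← Finset.sum_add_distrib]
  refine Finset.sum_congr rfl fun x _ => ?_
  have hcos : ∀ y : Fin N, Real.cos (z.1 x - z.1 y) = Real.cos (z.1 y - z.1 x) := fun y => by
    rw [← Real.cos_neg, neg_sub]
  rw [mul_add, Finset.mul_sum]
  simp_rw [mul_ite, mul_zero, hcos]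
  ring

end Literature.Barriers.AtomisticToContinuum.HeatConduction

namespace Literature.Barriers.AtomisticToContinuum

open Literature.MathematicalPhysics.KineticTheory.HeatConduction HeatConduction HeatConduction.RotorChain

/-- **De Roeck–Huveneers 2015, Theorem 1 (rotor chain): the current is a Liouville coboundary up
to `ε^{n+1}`, at every order `n`.** For `γ ≥ 0`, `T > 0` and `n ≥ 1` there is `C < ∞` such that
(for all sufficiently small `ε > 0`) for every odd `N ≥ 1` and every site `a`, there are smooth
`2π`-angle-periodic functions `U_a, G_a` on `Ω_N`, of zero Gibbs average, depending only on the
variables at sites `x` with `|x - a| ≤ C`, with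
`ε J_{a,a+1} = L_H U_a + ε^{n+1} G_a` and `⟨U_a²⟩_T ≤ C ε^{1/4}`, `⟨(∂_♯U_a)²⟩_T ≤ C ε^{-1/4}`,
`⟨G_a²⟩_T ≤ C`, `⟨(∂_♯G_a)²⟩_T ≤ C` for every coordinate derivative `∂_♯ ∈ {∂_{q_x}, ∂_{ω_x}}`
("in all orders in perturbation in `ε`, only local oscillations of the energy field (and hence no
persistent currents) can be produced by the dynamics"). [cite: DeRoeckHuveneers2015, §2.3 Thm 1] -/
def DeRoeckHuveneers2015_thm1 : Prop :=
  ∀ γ : ℝ, 0 ≤ γ → ∀ T : ℝ, 0 < T → ∀ n : ℕ, 1 ≤ n →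
    ∃ C : ℝ, ∃ ε₀ : ℝ, 0 < ε₀ ∧ ∀ ε : ℝ, 0 < ε → ε < ε₀ →
      ∀ N : ℕ, Odd N → ∀ a : Fin N,
        ∃ U G : PhaseSpace N → ℝ,
          ContDiff ℝ ∞ U ∧ ContDiff ℝ ∞ G ∧ IsAnglePeriodic N U ∧ IsAnglePeriodic N G ∧
          DependsOnlyNear N a C U ∧ DependsOnlyNear N a C G ∧
          Integrable U (gibbsMeasure N T ε γ) ∧ Integrable G (gibbsMeasure N T ε γ) ∧
          ∫ z, U z ∂(gibbsMeasure N T ε γ) = 0 ∧ ∫ z, G z ∂(gibbsMeasure N T ε γ) = 0 ∧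
          (∀ z : PhaseSpace N,
            ε * bondCurrent N a z = liouville N ε γ U z + ε ^ (n + 1) * G z) ∧
          Integrable (fun z => U z ^ 2) (gibbsMeasure N T ε γ) ∧
          ∫ z, U z ^ 2 ∂(gibbsMeasure N T ε γ) ≤ C * ε ^ (1 / 4 : ℝ) ∧
          Integrable (fun z => G z ^ 2) (gibbsMeasure N T ε γ) ∧
          ∫ z, G z ^ 2 ∂(gibbsMeasure N T ε γ) ≤ C ∧
          ∀ x : Fin N,
            Integrable (fun z => partialQ x U z ^ 2) (gibbsMeasure N T ε γ) ∧
            ∫ z, partialQ x U z ^ 2 ∂(gibbsMeasure N T ε γ) ≤ C * ε ^ (-(1 / 4) : ℝ) ∧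
            Integrable (fun z => partialP x U z ^ 2) (gibbsMeasure N T ε γ) ∧
            ∫ z, partialP x U z ^ 2 ∂(gibbsMeasure N T ε γ) ≤ C * ε ^ (-(1 / 4) : ℝ) ∧
            Integrable (fun z => partialQ x G z ^ 2) (gibbsMeasure N T ε γ) ∧
            ∫ z, partialQ x G z ^ 2 ∂(gibbsMeasure N T ε γ) ≤ C ∧
            Integrable (fun z => partialP x G z ^ 2) (gibbsMeasure N T ε γ) ∧
            ∫ z, partialP x G z ^ 2 ∂(gibbsMeasure N T ε γ) ≤ C

/-- **De Roeck–Huveneers 2015, Theorem 4 (rotor chain): energy is frozen for all polynomial times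
("an analog of Nekhoroshev estimates, at infinite volume and positive temperature").** For
`γ ≥ 0`, `T > 0` and `n ≥ 1` there is `C < ∞` such that for all sufficiently small `ε > 0`, every
odd `N`, every flow map `X^t_ε` of the chain and every discrete interval `I = {a₁, …, a₂}`:
`⟨(H_I(X^t_ε) - H_I)²⟩_T ≤ C ε^{1/4}` for all `0 ≤ t ≤ ε^{-n}`. [cite: DeRoeckHuveneers2015, §2.3 Thm 4] -/
def DeRoeckHuveneers2015_thm4 : Prop :=
  ∀ γ : ℝ, 0 ≤ γ → ∀ T : ℝ, 0 < T → ∀ n : ℕ, 1 ≤ n →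
    ∃ C : ℝ, ∃ ε₀ : ℝ, 0 < ε₀ ∧ ∀ ε : ℝ, 0 < ε → ε < ε₀ →
      ∀ N : ℕ, Odd N → ∀ Φ : ℝ → PhaseSpace N → PhaseSpace N, IsFlow N ε γ Φ →
        ∀ a₁ a₂ : Fin N, a₁ ≤ a₂ → ∀ t : ℝ, 0 ≤ t → t ≤ ε ^ (-(n : ℝ)) →
          Integrable (fun z => (intervalEnergy N ε γ a₁ a₂ (Φ t z) - intervalEnergy N ε γ a₁ a₂ z) ^ 2)
              (gibbsMeasure N T ε γ) ∧
            ∫ z, (intervalEnergy N ε γ a₁ a₂ (Φ t z) - intervalEnergy N ε γ a₁ a₂ z) ^ 2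
                ∂(gibbsMeasure N T ε γ) ≤ C * ε ^ (1 / 4 : ℝ)

/-- **De Roeck–Huveneers 2015, Theorem 2 (rotor chain): on every polynomial time scale `ε^{-n}t` the finite-time Green–Kubo conductivity vanishes faster than `ε^m`, `1 ≤ m < n`:** `lim_{t→∞} limsup_{ε→0⁺} limsup_{N→∞, N odd} (ε^{-m}/T²) ⟨(ε (ε^{-n}t)^{-1/2} ∫₀^{ε^{-n}t} 𝒥_N(X^s_ε) ds)²⟩_T = 0` for `γ ≥ 0`, `T > 0` and every choice of flow maps `X_ε` ("we do not see any transport on the time scales that we study"; "a strong indication that `κ(T, ε) = 𝒪(ε^m)` for any `m ≥ 1`").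
BARRIER (D-0021), AtomisticToContinuum/FouriersLaw:
technique_class: perturbation theory in the inter-site coupling `ε` around uncoupled anharmonic oscillators (anti-continuum / weak-coupling expansions `κ = ∑ κ_k ε^k`, KAM-type normal forms, weak-coupling scaling limits `ε → 0`, `t ∼ ε^{-n}`), for the rotor chain `H = ½∑ω² + ε∑(γ(1 - cos q_x) + 1 - cos(q_x - q_{x+1}))` and the DNLS chain (2.3) [cite: DeRoeckHuveneers2015, §2.3 Thms 1-2 and §2.4]; BARRIER AUDIT 2026-08-15 (`AnticontinuumLocalizationNarrow`, file `AnticontinuumLocalizationNarrow.lean`, all conjuncts proved): of this class the printed theorems cover exactly the POLYNOMIAL-WINDOW sub-class — certificates of transport, relaxation or a conductivity lower bound read off the dynamics on `[0, ε^{-n}t]` for some fixed `n` (scaling limits `t ∼ ε^{-n}`, expansions evaluated on such windows, KAM/Nekhoroshev-window estimates); expansions, asymptotics or lower bounds of the INFINITE-time `κ(T, ε)` (`t → ∞` before `ε → 0`) are constrained by no theorem of the source (scope_caveats (f))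
blocks: any proof of the POSITIVITY clause `0 < κ(T)` of `OscillatorChain.FouriersLawFor` (or of any torus version of it for rotors — the tree has none; `rotorChain ε γr γb` only registers the potentials — and, directly, of De Roeck–Huveneers' Green–Kubo `κ(T, ε) > 0`) for these chains by such an expansion — every order is transport-free (Theorem 1: `εJ_{a,a+1} = L_H U_a + ε^{n+1}G_a` for all `n`), and the finite-time conductivity on every time scale `ε^{-n}` is `o(ε^m)` (Theorem 2); the natural strengthening "`κ(T, ε) ≥ c ε^m` for some `m`" (equivalently, by the exact scaling `κ(ε,T) = σ⁻¹κ(σ²ε, σ²T)`, "`κ(T) ≥ c T^{-m}` as `T → ∞`") is conjectured false: "`κ(T, ε) = 𝒪(ε^m)` for any `m ≥ 1`" [cite: DeRoeckHuveneers2015, §2.3 after Thm 1 and §2.4]; the weak-coupling route to Fourier's law (weak coupling limit `ε → 0`, `t ε^{-2}`, then hydrodynamic limit) yields a trivial (zero) macroscopic diffusivity at every polynomial order for these deterministic chains ("these scaling limits are trivial in the sense that we do not see any transport on the time scales that we study") [cite: DeRoeckHuveneers2015, §2.3 before Thm 2] [cite: Bernardin2014, §2.1.3]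
because: each uncoupled oscillator is one-dimensional and strongly anharmonic, so its frequency depends on its energy; in the product Gibbs state neighbouring frequencies are effectively random, resonances able to transfer energy perturbatively are rare, and the drift of the resonant spots as energy moves is itself slower than any power of `ε`; a KAM-like change of variables then removes the current to order `ε^{n+1}` up to a Liouville coboundary `L_H U_a` with `⟨U_a²⟩ ≤ Cε^{1/4}`, whence energies of intervals stay frozen up to times `ε^{-n}` (Theorem 4) [cite: DeRoeckHuveneers2015, §1 and §§3-5]
evasions_known: none published for the deterministic chains — "we do not even rigorously know whether the chains we consider are normal conductors for some `ε > 0`, that is, whether `κ(T, ε) < ∞`" [cite: DeRoeckHuveneers2015, §2.3 after Thm 2]; with an added energy-conserving noise of intensity `ε^{n+1}` the conductivity is finite and `≤ C_n εⁿ`, i.e. attributable to the noise (Theorem 3) [cite: DeRoeckHuveneers2015, §2.3 Thm 3]; numerically the rotor and DNLS chains are normal conductors at fixed `ε > 0`, "so that we expect localization of energy to be at best asymptotic"; for a disordered non-linear chain "it is argued that the localization is broken at a scale that is roughly of the order of `e^{-c ln³(1/ε)}`" and the authors "conjecture that, here as well, localization does not persist on longer times than that" [cite: DeRoeckHuveneers2015,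 §2.4 "How optimal are our bounds?"]; (barrier audit 2026-08-15) with an energy-conserving noise of FIXED intensity `λ > 0` on the cells the formal weak-coupling expansion `κ(ε, λ) = ε²∑_{n≥2}ε^{n-2}κ_n(λ)` has, for the rotor chain, a strictly positive second-order coefficient with `limsup_{λ→0}κ₂(λ) < ∞`, and whether `κ₂(λ) → 0` as `λ → 0` is stated as undecided [cite: BernardinHuveneersLebowitzLiveraniOlla2015, §8.3 Prop. 8.6 (arXiv numbering)]; the expected (heuristic) carrier of transport is rare mobile chaotic spots hopping at rate `γ ∼ g^{1/2}e^{-c(log βg)²}` [cite: DeRoeckHuveneers2019, §2], giving the heuristic LOWER bound `κ(T) ∼ g e^{-C(log(√(UT)/J))²}` [cite: Huveneers2017, §2.3] — positive, super-polynomially small, invisible on every polynomial window; numerically fitted power laws for the relaxation time (`t₀ ∼ g^{-5}`, `g^{-6.5}`) are pre-asymptotic, since a literal power law for the `L²(Gibbs)` relaxation of interval energies contradicts Theorem 4 [cite: DeRoeckHuveneers2019, §2]; transfer-of-energy (Arnold diffusion) orbits exist for A PRIORI UNSTABLE pendulum lattices with `O(1)` gravity and designed `C⁴` couplings [cite: GiulianiGuardia2023,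 Thm 1.1], while for a priori stable lattices such as weakly coupled rotators their construction "is an outstanding open problem" [cite: GiulianiGuardia2023, §1 before §1.1]
scope_caveats: proved for the rotor chain (2.1) and the DNLS chain (2.3) in `d = 1` only; it is NOT proved for the quartic pinned chain `∑(p²/2 + q⁴/4 + (ε/2)(q_x - q_{x+1})²)` (2.12) — "The generalisation of our theorems to the chain defined by (2.12) appears thus to us as an open question" — hence not for the conjunct's `pinnedChain ω₂ lam β γ`, whose FPU-`β` coupling `r²/2 + βr⁴/4` is moreover not weak at any temperature; the statement `κ(T, ε) = 𝒪(ε^m)` itself is a CONJECTURE (the limits `t → ∞` and `ε → 0` are not exchanged), only the finite-time version (Theorem 2) and the frozen-energy bound (Theorem 4) are theorems; higher dimensions are conjectured, not proved (§2.4); Theorems 1–2 are EQUILIBRIUM (Green–Kubo, finite-time) statements, while the positivity clause of `FouriersLawFor` concerns the boundary-driven steady-state conductivity, whose identification with `κ_GK` is itself unproved ("it is not even clear how to prove … `κ = κ_GK`") [cite: BonettoLebowitzReyBellet2000, §7]; only Theorems 1, 2, 4 for the rotor chain are restated in Lean here; (f) (barrier audit 2026-08-15, `AnticontinuumLocalizationNarrow`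 conjuncts (2)–(5), proved) Theorem 2's triple limit constrains polynomial time windows ONLY: every family of current autocovariances with `sup_{s≥0}|C_ε(s)| = O(ε^∞)` satisfies its conclusion at ALL orders `(m, n)` whatever its Green–Kubo integral, and the Ornstein–Uhlenbeck family with rate `e^{-1/ε}` does so with window conductivity `→ 1` for every `ε` — so "every order is transport-free" must be read as "on windows `ε^{-n}t`, `n > m`", and neither `κ(T, ε) = 𝒪(ε^m)` nor the impossibility of an `ε`-power LOWER bound on the infinite-time `κ_GK` follows from any theorem of the source; (g) (same audit, computation in the audit notes, not formalised) naive FIXED-time second-order perturbation theory of the rotor chain sees transport: at `ε = 0` (free rotation, product Gibbs state) `lim_{τ→∞} lim_{N→∞} τ⁻¹T⁻²⟨(∫₀^τ𝒥_N∘X₀^s ds)²⟩ = (√π/4)T^{-3/2} > 0` (free resonant streaming, `πE[ω₁²δ(ω₀ - ω₁)]/T²`), a contribution caged by first-order resonances (pendulum pairs) on times `∼ ε^{-1/2}`; Theorem 2 needs `n > m` and says nothing for windows `ε^{-n}t` with `n ≤ m`; (h) the pinning of (2.1) is `εγ(1 - cos q_x)`, scaled WITH `ε` (a priori stable unperturbed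 system): pendulum lattices with `O(1)` pinning (a priori unstable) are not covered
status: theorem (established) [cite: DeRoeckHuveneers2015, §2.3 Thms 1, 2, 4 with proofs in §§3-7]
[cite: DeRoeckHuveneers2015, §2.3 Thm 2] -/
def DeRoeckHuveneers2015_thm2 : Prop :=
  ∀ γ : ℝ, 0 ≤ γ → ∀ T : ℝ, 0 < T → ∀ n m : ℕ, 1 ≤ m → m < n →
    ∀ Φ : ℝ → (N : ℕ) → ℝ → PhaseSpace N → PhaseSpace N,
      (∀ (ε : ℝ) (N : ℕ), 0 < ε → IsFlow N ε γ (Φ ε N)) →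
      Tendsto
        (fun t : ℝ =>
          limsup (fun ε : ℝ =>
            limsup (fun N : ℕ => finiteTimeConductivity γ T ε n m N (Φ ε N) t)
              (atTop ⊓ 𝓟 {N | Odd N}))
            (𝓝[>] 0))
        atTop (𝓝 0)

/-- Unfolding the barrier fact at given parameters. [folklore] -/
theorem DeRoeckHuveneers2015_thm2.tendsto (h : DeRoeckHuveneers2015_thm2) {γ T : ℝ} (hγ : 0 ≤ γ)
    (hT : 0 < T) {n m : ℕ} (hm : 1 ≤ m) (hmn : m < n)
    (Φ : ℝ → (N : ℕ) → ℝ → PhaseSpace N → PhaseSpace N)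
    (hΦ : ∀ (ε : ℝ) (N : ℕ), 0 < ε → IsFlow N ε γ (Φ ε N)) :
    Tendsto
      (fun t : ℝ =>
        limsup (fun ε : ℝ =>
          limsup (fun N : ℕ => finiteTimeConductivity γ T ε n m N (Φ ε N) t)
            (atTop ⊓ 𝓟 {N | Odd N}))
          (𝓝[>] 0))
      atTop (𝓝 0) :=
  h γ hγ T hT n m hm hmn Φ hΦ

/-- Theorem 4 at `ε`-independent data: under the fact, for the uncoupled-limit witnesses one gets
the frozen-energy bound for every flow of the coupled chain on the whole window `[0, ε^{-n}]`.
[cite: DeRoeckHuveneers2015, §2.3 Thm 4] -/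
theorem DeRoeckHuveneers2015_thm4.bound (h : DeRoeckHuveneers2015_thm4) {γ T : ℝ} (hγ : 0 ≤ γ)
    (hT : 0 < T) {n : ℕ} (hn : 1 ≤ n) :
    ∃ C : ℝ, ∃ ε₀ : ℝ, 0 < ε₀ ∧ ∀ ε : ℝ, 0 < ε → ε < ε₀ →
      ∀ N : ℕ, Odd N → ∀ Φ : ℝ → PhaseSpace N → PhaseSpace N, IsFlow N ε γ Φ →
        ∀ a₁ a₂ : Fin N, a₁ ≤ a₂ → ∀ t : ℝ, 0 ≤ t → t ≤ ε ^ (-(n : ℝ)) →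
          ∫ z, (intervalEnergy N ε γ a₁ a₂ (Φ t z) - intervalEnergy N ε γ a₁ a₂ z) ^ 2
              ∂(gibbsMeasure N T ε γ) ≤ C * ε ^ (1 / 4 : ℝ) := by
  obtain ⟨C, ε₀, hε₀, hall⟩ := h γ hγ T hT n hn
  exact ⟨C, ε₀, hε₀, fun ε hε hεε N hN Φ hΦ a₁ a₂ ha t ht htε =>
    (hall ε hε hεε N hN Φ hΦ a₁ a₂ ha t ht htε).2⟩

end Literature.Barriers.AtomisticToContinuum

end
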